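/-
Origin: expansion seat `prover-pub-hodgecm-mc-carch-1-g4-0`, handover #CA34 2026-08-20T08:16Z md5 7ccb99dd1c00 (184 l., 9 decls; NEW additive leaf; imports #CA33 (this kit) only; RUN 45; INSTALL after #CA33; cert certs/ax-ArchKTypeOfLineSection-7ccb99dd1c00.log: rc 0 / 25 s / 0 warnings / 9/9 trio) (`HOME/mc/pub-hodgecm-mc-carch-1/pkg45/HodgeCM/Model/ArchKTypeOfLineSection.lean`, md5 7ccb99dd1c00, 184 lines);
landed by the gen-17 packager (p-g17) in gate run 45 as `HodgeCM/Model/ArchKTypeOfLineSection.lean` (verbatim).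
-/
/-
Copyright (c) 2026. Released under Apache 2.0 license as described in the file LICENSE.
Cell pub-hodgecm, MODEL layer (construction prover mc-carch-1, gen 4), BINDER-OWNERS row 12 `C`, junction (C-Λ) § 5, item (A2b):
the Stage-B characters on the `ι₁`-SECTION and the (χ)₀/(χ)₁ inputs DISCHARGED at the R1 pin.
-/
import Summits.HodgeConjecture.HodgeCM.Model.ArchKTypeOfLineTables

/-!
# (C-Λ) § 5 (A2b): the R1 line characters on the `ι₁`-section, and (χ)₀/(χ)₁ discharged at the R1 pin

Under the canonical-representative guard `(mk ι₁).embedding = ι₁` (the first clause of E's `SInstance.GOG`), the local matrix of the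
`ι₁`-section `archSectionFrameOf V u` at the place of `ι₁` is `T u T⁻¹` UN-twisted (`embTwist ι₁ = id`), so its determinant is `det u` and a
Stage-B character `EtaChi.η χV χW V c` of archimedean type `nV` takes the value `(det u)^{nV (mk ι₁)}` on `((archSectionFrameOf V u)^𝔸, 1)`
(`eta_archSectionFrameOf_one`; K-1 `coe_cmDetTwistChar_cmKTypeHom_archSingle_one` through #CA2's frame identities).  Consequences:

* `νOf_archSectionFrameOf`, `etaT₁_archSectionFrameOf_one`, `etaT₀_archSectionFrameOf_one` — the η-parts of the R1 line scalars on the section are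
  `(det u)^{n₁ (mk ι₁)}` and `(det u)^{nV (mk ι₁) − n₁ (mk ι₁)}`; on `Stab(x₀) = blockU(K21)`, `det (blockU (A,d)) = det A · d` (`det_mat_blockU`);
* **`hχ_one_R1`** — the `hχ₁` input of #CA25 `archKTypeOfSideG` at `η₁ := etaT₁ V c.D (EtaChi.η χV χW V c) (νOf ν₁ V c)`, `ev := lineVacExponentsOne …`,
  HOLDS when `ν₁ V c` has type `n₁R …` (#CA33; `n₁R_mk = −eP₁`, binder-2's `eP₁ − eQ₁ = 1`);
* **`hχ_zero_R1`** — the `hχ₀` input at `η₀ := etaT₀ …`, `ev := lineVacExponentsZero …` HOLDS when moreover `χV V c` has type `nVR …`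
  (#CA29 `hχ_zero_of_archType` absorbs the see-saw factor: `nVR_mk − n₁R_mk = −eP₀ − ℓ`).

With #CA33's `hdef_zero_R1`/`hdef_one_R1` this closes ALL FOUR PROVE inputs (c5)₀/(χ)₀/(c5)₁/(χ)₁ of the row-12 term at the R1 pin for the
read-off choice `χV := EtaChi.χOfType nVR`, `ν₁ := EtaChi.χOfType n₁R` (generic CM type; no cite; E's type unchanged).  0 records, 0 `def … : Prop`.
-/

set_option autoImplicit false

noncomputable section

open NumberField NumberField.InfinitePlace NumberField.mixedEmbedding IsDedekindDomain
open scoped Matrix Classical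
open ComplexConjugate
open Literature.Geometry.ComplexHyperbolic Literature.Geometry.ComplexHyperbolic.BallModel
open Literature.NumberTheory.Automorphic Literature.NumberTheory.Automorphic.UnitaryGroup Literature.NumberTheory.Automorphic.U21
open Literature.NumberTheory.Weil1964
open Literature.NumberTheory.GelbartRogawski1991 Literature.NumberTheory.GelbartRogawski1991.UnitaryDualPair
open Literature.RepresentationTheory.KonnoKonno2007
open HodgeCM.Adelic HodgeCM.PerL34 HodgeCM.Model.HypCensus HodgeCM.Model.ArchSideTerm

namespace HodgeCM.Model

section Section

variable
  (χV χW ν₁ : ∀ {L : CMField} {ι₁ : L →+* ℂ} (_V : HermSpace3 L ι₁) (_c : SeesawCtx L),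
    ContinuousMonoidHom (Literature.NumberTheory.Automorphic.relNormOneIdeles (↥(NumberField.maximalRealSubfield (L : Type))) (L : Type) ⧸
      Literature.NumberTheory.Automorphic.relNormOneRat (↥(NumberField.maximalRealSubfield (L : Type))) (L : Type)) Circle)
variable {L : CMField} {ι₁ : L →+* ℂ} (V : HermSpace3 L ι₁) (c : SeesawCtx L)
variable (hemb : (InfinitePlace.mk ι₁).embedding = ι₁)

/-! ## § 1 The determinant of the section's local matrix -/

include hemb in
/-- under `(mk ι₁).embedding = ι₁` the un-twisted local matrix of the section at `u` has determinant `det u`. -/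
theorem det_coe_archLocalOfEmb_formEquivU21_symm (u : U21) :
    (((archLocalOfEmb (L : Type) 3 V.Hm ι₁ (isComplex_mk_of_isCMField (L : Type) ι₁)
        ((formEquivU21 (L : Type) V.Hm ι₁ V.sylvesterFrame
          (formCongr_eq_of_conjTranspose (L : Type) ι₁ V.Hm V.sylvesterFrame (sylvesterFrame_J V))).symm u) :
        archLocal (L : Type) 3 V.Hm (UnitaryGroup.cmPlace (L : Type) ι₁)) : GL (Fin 3) ℂ) : Matrix (Fin 3) (Fin 3) ℂ).det =
      (mat u).det := by
  rw [coe_archLocalOfEmb, coe_formEquivU21_symm_apply]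
  change (((V.sylvesterFrame * (u : GL (Fin 3) ℂ) * V.sylvesterFrame⁻¹ : GL (Fin 3) ℂ) : Matrix (Fin 3) (Fin 3) ℂ).map
    (embTwist (L : Type) ι₁)).det = _
  rw [← RingHom.mapMatrix_apply, ← RingHom.map_det, embTwist_apply_of_eq (L : Type) ι₁ hemb, Units.val_mul, Units.val_mul,
    Matrix.det_mul, Matrix.det_mul, mul_comm (Matrix.det (V.sylvesterFrame : Matrix (Fin 3) (Fin 3) ℂ)), mul_assoc, ← Matrix.det_mul,
    ← Units.val_mul, mul_inv_cancel, Units.val_one, Matrix.det_one, mul_one]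

/-- `det (diag(A, d)) = det A · d` on the block subgroup. -/
theorem det_mat_blockU (k : K21) : (mat (blockU k)).det = (matA k).det * sclD k := by
  rw [mat_blockU, Matrix.det_fin_three, Matrix.det_fin_two]
  simp [bmat]
  ring

/-- (Ported verbatim from the HodgeCMPerL package; no docstring in the source.) -/
theorem det_mat_stabilizer (u : MulAction.stabilizer U21 x₀) :
    (mat (u : U21)).det = (matA (stabilizerEquivK21.symm u)).det * sclD (stabilizerEquivK21.symm u) := by
  have hu : (u : U21) = blockU (stabilizerEquivK21.symm u) := by
    rw [← coe_blockK, ← stabilizerEquivK21_apply, MulEquiv.apply_symm_apply]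
  rw [hu, det_mat_blockU]

/-! ## § 2 Stage-B characters on the section -/

include hemb in
/-- **a Stage-B character on the `ι₁`-section**: `η((archSectionFrameOf V u)^𝔸, 1) = (det u)^{nV (mk ι₁)}` for `χV` of type `nV`. -/
theorem eta_archSectionFrameOf_one {nV : InfinitePlace (L : Type) → ℤ} (hnV : UnitaryLineChar.HasArchType (L : Type) (χV V c) nV) (u : U21) :
    ((EtaChi.η @χV @χW V c (UnitaryGroup.archToAdelic (↥(maximalRealSubfield L)) L (IsCMField.complexConj L) 3 (Matrix.diagonal (frameD V))
        (archSectionFrameOf V u), 1) : ℂˣ) : ℂ) = (mat u).det ^ nV (InfinitePlace.mk ι₁) := by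
  rw [archSectionFrameOf_apply, archToAdelic_archFrameCongr, archToAdelic_archSectionArchOf]
  have h := coe_cmDetTwistChar_cmKTypeHom_archSingle_one (L : Type) (frameD V) (frameD_ne V) (dW c.D) (dW_ne c.D) (χV V c) (χW V c)
    (UnitaryGroup.cmPlace (L : Type) ι₁) hnV V.Hm (frameG V) (frame_congr V)
    (archLocalOfEmb (L : Type) 3 V.Hm ι₁ (isComplex_mk_of_isCMField (L : Type) ι₁)
      ((formEquivU21 (L : Type) V.Hm ι₁ V.sylvesterFrame
        (formCongr_eq_of_conjTranspose (L : Type) ι₁ V.Hm V.sylvesterFrame (sylvesterFrame_J V))).symm u))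
  rw [det_coe_archLocalOfEmb_formEquivU21_symm V hemb] at h
  exact h

include hemb in
/-- the R1 twist on the section: `ν((archSectionFrameOf V u)^𝔸) = (det u)^{n₁ (mk ι₁)}`. -/
theorem νOf_archSectionFrameOf {n₁ : InfinitePlace (L : Type) → ℤ} (hn₁ : UnitaryLineChar.HasArchType (L : Type) (ν₁ V c) n₁) (u : U21) :
    ((νOf @ν₁ V c (UnitaryGroup.archToAdelic (↥(maximalRealSubfield L)) L (IsCMField.complexConj L) 3 (Matrix.diagonal (frameD V))
        (archSectionFrameOf V u)) : ℂˣ) : ℂ) = (mat u).det ^ n₁ (InfinitePlace.mk ι₁) :=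
  eta_archSectionFrameOf_one @ν₁ @ν₁ V c hemb hn₁ u

include hemb in
/-- the η₁-part of the R1 line-1 scalar on the section. -/
theorem etaT₁_archSectionFrameOf_one {n₁ : InfinitePlace (L : Type) → ℤ} (hn₁ : UnitaryLineChar.HasArchType (L : Type) (ν₁ V c) n₁) (u : U21) :
    ((etaT₁ V c.D (EtaChi.η @χV @χW V c) (νOf @ν₁ V c)
        (UnitaryGroup.archToAdelic (↥(maximalRealSubfield L)) L (IsCMField.complexConj L) 3 (Matrix.diagonal (frameD V))
          (archSectionFrameOf V u), 1) : ℂˣ) : ℂ) = (mat u).det ^ n₁ (InfinitePlace.mk ι₁) := by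
  rw [etaT₁_apply_mk_one, νOf_archSectionFrameOf @ν₁ V c hemb hn₁]

include hemb in
/-- the η₀-part of the R1 line-0 scalar on the section. -/
theorem etaT₀_archSectionFrameOf_one {nV n₁ : InfinitePlace (L : Type) → ℤ} (hnV : UnitaryLineChar.HasArchType (L : Type) (χV V c) nV)
    (hn₁ : UnitaryLineChar.HasArchType (L : Type) (ν₁ V c) n₁) (u : U21) :
    ((etaT₀ V c.D (EtaChi.η @χV @χW V c) (νOf @ν₁ V c)
        (UnitaryGroup.archToAdelic (↥(maximalRealSubfield L)) L (IsCMField.complexConj L) 3 (Matrix.diagonal (frameD V))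
          (archSectionFrameOf V u), 1) : ℂˣ) : ℂ) = (mat u).det ^ (nV (InfinitePlace.mk ι₁) - n₁ (InfinitePlace.mk ι₁)) := by
  rw [etaT₀_apply_mk_one, Units.val_mul, Units.val_inv_eq_inv_val, νOf_archSectionFrameOf @ν₁ V c hemb hn₁,
    eta_archSectionFrameOf_one @χV @χW V c hemb hnV, ← zpow_neg, ← zpow_add₀ (det_mat_ne_zero u)]
  congr 1
  ring

end Section

/-! ## § 3 (χ)₁ and (χ)₀ discharged at the R1 pin -/

section Chi

variable
  (χV χW ν₁ : ∀ {L : CMField} {ι₁ : L →+* ℂ} (_V : HermSpace3 L ι₁) (_c : SeesawCtx L),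
    ContinuousMonoidHom (Literature.NumberTheory.Automorphic.relNormOneIdeles (↥(NumberField.maximalRealSubfield (L : Type))) (L : Type) ⧸
      Literature.NumberTheory.Automorphic.relNormOneRat (↥(NumberField.maximalRealSubfield (L : Type))) (L : Type)) Circle)
variable {L : CMField} {ι₁ : L →+* ℂ} (V : HermSpace3 L ι₁) (c : SeesawCtx L)
variable
  (hGR : (cmSplittingDatum (L : Type) finProdFinEquiv (frameD V) (frameD_real V) (frameD_ne V) (dW c.D) (dW_real c.D) (dW_ne c.D)).CompatibleSplitting)
  (hGR₀ : (cmSplittingDatum (L : Type) (e₁) (frameD V) (frameD_real V) (frameD_ne V) (lineVec (L : Type) (dW c.D 0))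
    (fun _ => dW_real c.D 0) (fun _ => dW_ne c.D 0)).CompatibleSplitting)
  (hGR₁ : (cmSplittingDatum (L : Type) (e₁) (frameD V) (frameD_real V) (frameD_ne V) (lineVec (L : Type) (dW c.D 1))
    (fun _ => dW_real c.D 1) (fun _ => dW_ne c.D 1)).CompatibleSplitting)
  (h₁W : (∀ j, 0 < (ι₁ (dW c.D j)).re) ∨ ∀ j, (ι₁ (dW c.D j)).re < 0)
  (hpos₀ : 0 < cmXW (L : Type) (frameD V) (lineVec (L : Type) (dW c.D 0)) (fun _ => dW_real c.D 0) ι₁ (HypCensus.cmPlace (L : Type) ι₁) 0)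
  (hpos₁ : 0 < cmXW (L : Type) (frameD V) (lineVec (L : Type) (dW c.D 1)) (fun _ => dW_real c.D 1) ι₁ (HypCensus.cmPlace (L : Type) ι₁) 0)
  (hemb : (InfinitePlace.mk ι₁).embedding = ι₁)
  (hnV : UnitaryLineChar.HasArchType (L : Type) (χV V c) (nVR V c hGR hGR₀ hGR₁ h₁W hpos₀ hpos₁))
  (hn₁ : UnitaryLineChar.HasArchType (L : Type) (ν₁ V c) (n₁R V c hGR₁ h₁W hpos₁))

include hemb hn₁ in
/-- **(χ)₁ AT THE R1 PIN: the `hχ₁` input of #CA25 `archKTypeOfSideG` HOLDS** for `η₁ := etaT₁ … (EtaChi.η χV χW V c) (νOf ν₁ V c)` and `ν₁` of type `n₁R`. -/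
theorem hχ_one_R1 (u : MulAction.stabilizer U21 x₀) :
    ((lineScalar_one V c.D hGR hGR₀ hGR₁ (etaT₁ V c.D (EtaChi.η @χV @χW V c) (νOf @ν₁ V c)) (u : U21) : ℂˣ) : ℂ) *
        ((matA (stabilizerEquivK21.symm u)).det ^ (lineVacExponentsOne V c hGR₁ h₁W (posIdxEquivUnit hpos₁) (negIdxEquivEmpty hpos₁)).eP *
          sclD (stabilizerEquivK21.symm u) ^ (lineVacExponentsOne V c hGR₁ h₁W (posIdxEquivUnit hpos₁) (negIdxEquivEmpty hpos₁)).eQ) =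
      star (sclD (stabilizerEquivK21.symm u)) := by
  have hd := lineVacExponentsOne_eP_sub_eQ V c hGR₁ h₁W (posIdxEquivUnit hpos₁) (negIdxEquivEmpty hpos₁)
  refine lineScalar_identity_of_exponents (χ := lineScalar_one V c.D hGR hGR₀ hGR₁ (etaT₁ V c.D (EtaChi.η @χV @χW V c) (νOf @ν₁ V c)))
    (m := -(lineVacExponentsOne V c hGR₁ h₁W (posIdxEquivUnit hpos₁) (negIdxEquivEmpty hpos₁)).eP)
    (m' := -(lineVacExponentsOne V c hGR₁ h₁W (posIdxEquivUnit hpos₁) (negIdxEquivEmpty hpos₁)).eP) (fun u => ?_) (by omega) (by omega) u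
  rw [etaT₁_def, lineScalar_one_fst_mul_eta₁]
  change ((νOf @ν₁ V c (UnitaryGroup.archToAdelic (↥(maximalRealSubfield L)) L (IsCMField.complexConj L) 3 (Matrix.diagonal (frameD V))
    (archSectionFrameOf V (u : U21))) : ℂˣ) : ℂ) = _
  rw [νOf_archSectionFrameOf @ν₁ V c hemb hn₁, n₁R_mk, det_mat_stabilizer, mul_zpow]

include hemb hnV hn₁ in
/-- **(χ)₀ AT THE R1 PIN: the `hχ₀` input of #CA25 `archKTypeOfSideG` HOLDS** for `η₀ := etaT₀ … (EtaChi.η χV χW V c) (νOf ν₁ V c)`, `χV` of type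
`nVR` and `ν₁` of type `n₁R` (the see-saw factor absorbed by `ℓ = lambdaExponent` through #CA29). -/
theorem hχ_zero_R1 (u : MulAction.stabilizer U21 x₀) :
    ((lineScalar_zero V c.D hGR hGR₀ hGR₁ (etaT₀ V c.D (EtaChi.η @χV @χW V c) (νOf @ν₁ V c)) (u : U21) : ℂˣ) : ℂ) *
        ((matA (stabilizerEquivK21.symm u)).det ^ (lineVacExponentsZero V c hGR₀ h₁W (posIdxEquivUnit hpos₀) (negIdxEquivEmpty hpos₀)).eP *
          sclD (stabilizerEquivK21.symm u) ^ (lineVacExponentsZero V c hGR₀ h₁W (posIdxEquivUnit hpos₀) (negIdxEquivEmpty hpos₀)).eQ) =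
      star (sclD (stabilizerEquivK21.symm u)) := by
  have hd := lineVacExponentsZero_eP_sub_eQ V c hGR₀ h₁W (posIdxEquivUnit hpos₀) (negIdxEquivEmpty hpos₀)
  refine hχ_zero_of_archType V c.D hGR hGR₀ hGR₁ (etaT₀ V c.D (EtaChi.η @χV @χW V c) (νOf @ν₁ V c)) h₁W
    (m := nVR V c hGR hGR₀ hGR₁ h₁W hpos₀ hpos₁ (InfinitePlace.mk ι₁) - n₁R V c hGR₁ h₁W hpos₁ (InfinitePlace.mk ι₁))
    (lineVacExponentsZero V c hGR₀ h₁W (posIdxEquivUnit hpos₀) (negIdxEquivEmpty hpos₀)) (fun u => ?_) ?_ ?_ u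
  · rw [etaT₀_archSectionFrameOf_one @χV @χW @ν₁ V c hemb hnV hn₁, det_mat_stabilizer]
  · rw [nVR_mk, n₁R_mk]; ring
  · rw [nVR_mk, n₁R_mk]; omega

end Chi

end HodgeCM.Model

end
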